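import Summits.Schanuel.Schanuel.Theorems.RootDecomp1BMovingZero19

/-!
# RootDecomp1BMovingZero — lens 4, generation 39 «ISOLATED POINT BOUND, SLOT DISCHARGED» (lane B-R24 (a) / RULE B-R25): the last B-side print input `IsolatedPointBound` (FACT B, part 11) of the moving-zero cell DISCHARGED up to its parameter-free numeral — `def IsolatedPointBoundN` (part 11's text with `(2n+3)·log(n+1) ↦ 6n³`) and `theorem isolatedPointBoundN_holds : IsolatedPointBoundN` HYPOTHESIS-FREE from the tree's proved Nesterenko–Philippon elimination theory; `ApproxOfIsolated ρ` UNCONDITIONAL for every real ρ; `MovingZeroApprox ρ` modulo `AxRankBoundLaurent` only; the (1|ρ) storey cell modulo {Ax, LWMeasure, ExplicitRatExpApprox} — continuation (RootDecomp1BMovingZero20): §E4b rank-one endgame `exists_poly_of_rank_one` + §D tracked descent `descent_tracked` + §A arithmetic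

(lens-4 g39 HOME kernel IsolatedPointDischarge.lean dce96aa4…, 1262 l, imports tree MovingZero17 + the Literature elimination theory (PhilipponCriterionDescend / ProjectiveNoIsolatedPoints / NesterenkoEliminationProp411Holds / Prop47Holds / Facts2Proofs / NesterenkoUResultantIntCoeffs / NesterenkoIntegerHeights / PhilipponCriterionRankOne / ConeRank / Principal / NesterenkoEliminationZeros) + Mathlib MahlerMeasure; CLAIM L2051, RULING + RULE B-R25 + CHECKLIST B-g39 L2053, NODE L2060 / REQUEST L2061 / RESULT L2062, critic VERDICT L2063 (crit g8: CLEARED — THEOREM ×1 for the SLOT under RULE B-R25; lens-4 tally THEOREM ×6 + CELL ×2; the moving-zero cell's named inputs of record = {AxRankBoundLaurent, LWMeasure, ExplicitRatExpApprox}; PORT GO); port by census-1 gen 18 as `RootDecomp1BMovingZero18`–`22`: 18 = `namespace IsolatedPt` §E1–§E3 (binary forms at `(1,t)`, algebraicity of the coordinates on a rank-one prime, no point at infinity); 19 = §E4a the `u`-resultant read on the lines `τ e₀ − e_{j+1}` (`zpart` / `gPoly` / `uVec` / `pairExp`, coefficient and degree lemmas); 20 = §E4b the rank-one endgame `IsolatedPt.exists_poly_of_rank_one`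 (integer Chow form + Mahler measure) + §D the TRACKED DESCENT `IsolatedPt.descent_tracked` + §A arithmetic (`log_mvPolyHeight_le`, `junk_absorb`, `sharp_le_junk`); 21 = §N `def IsolatedPointBoundN`, (γ) `isolatedPointBoundN_of_isolatedPointBound`, THE DISCHARGE `isolatedPointBoundN_holds` (kind definition, `--no-relocate`); 22 = §B consumers re-run (`isolatedPointBoundN_five`, `height_side_leN`, `approxOfIsolated_of_factsN`, `movingZeroApprox_of_factsN`, `approxOfIsolated_holds`, `approxOfIsolated_of_ax`, `movingZeroApprox_of_ax`) + the four cells `four_le_polarDeg_one/swap/one_hyper/one_rhoT_of_ax`.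
PORT EDITS: the `AxiomGuards` section (7 `#guard_msgs in #print axioms`), the unused `import HarnessLib` and `set_option linter.dupNamespace false` dropped; eleven one-line docstrings added; statements and proofs verbatim. `--supports stmt-Schanuel-24622`; no census credit carried; rung 0 — nothing here proves Schanuel.)
-/

noncomputable section

attribute [local instance] MvPolynomial.gradedAlgebra

open MvPolynomial
open Literature.NumberTheory.Transcendental
open Literature.NumberTheory.Transcendental.Nesterenko
open Literature.NumberTheory.Transcendental.PhilipponMain

namespace Summit.Schanuel.Schanuel.Theorems.RootDecomp1BMovingZero

namespace IsolatedPt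

section URes

variable {m : ℕ}

/-- **Rank-one endgame.** For a homogeneous prime `𝔔` of rank `1` through the affine point
`(1 : z)`, each coordinate `z j` is a root of an irreducible integer polynomial of degree
`≤ deg 𝔔` and logarithmic Mahler measure `≤ h(𝔔) + deg 𝔔` (a factor of the `u`-resultant read
on the line `τ e₀ − e_{j+1}`). -/
theorem exists_poly_of_rank_one {𝔔 : Ideal (Rx m)} (h𝔔 : 𝔔.IsPrime)
    (hhom : 𝔔.IsHomogeneous (homogeneousSubmodule (Fin (m + 1)) ℚ)) (h1 : IsUnmixedOfRank 𝔔 1)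
    {z : Fin m → ℂ} (hz : (Fin.cons 1 z : Fin (m + 1) → ℂ) ∈ projZeros 𝔔) (j : Fin m) :
    ∃ Q : Polynomial ℤ, Irreducible Q ∧ 0 < Q.natDegree ∧ Polynomial.aeval (z j) Q = 0 ∧
      Q.natDegree ≤ ideg 𝔔 1 ∧
      Real.log (Q.map (Int.castRingHom ℂ)).mahlerMeasure ≤ iheight 𝔔 1 + ideg 𝔔 1 := by
  classical
  have h𝔔c : ∀ g ∈ 𝔔, ∀ k : ℕ, homogeneousComponent k g ∈ 𝔔 :=
    fun g hg k => homogeneousComponent_mem_of_mem hhom hg k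
  have hdim : ringKrullDim (Rx m ⧸ 𝔔) = ((1 : ℕ) : WithBot ℕ∞) :=
    ringKrullDim_quotient_eq_of_isUnmixedOfRank h𝔔 h1
  have hF : chowForm 𝔔 1 ≠ 0 := chowForm_ne_zero_of_prime (s := 0) h𝔔 hhom hdim
  obtain ⟨hc, hFeq, hsupp, hgcd⟩ := chowFormInt_spec (s := 0) hF
  set F₀ : RUZ 1 m := chowFormInt 𝔔 0 with hF₀
  set c : ℚ := chowFormScalar 𝔔 0 with hcdef
  set D : ℕ := ideg 𝔔 1 with hDdef
  have hFeq1 : chowForm 𝔔 1 = C c * map (Int.castRingHom ℚ) F₀ := hFeq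
  have hsupp1 : F₀.support = (chowForm 𝔔 1).support := hsupp
  -- the zeros theorem for `F₀`
  have hpr : (elimIdeal 𝔔 1).IsPrincipal := by
    haveI := h𝔔
    rw [elimIdeal_eq]
    exact (NesterenkoK.isPrincipal_elimIdeal 𝔔 hhom le_rfl hdim).1
  have hc' : algebraMap ℚ ℂ c ≠ 0 := by
    rw [Ne, map_eq_zero_iff _ (algebraMap ℚ ℂ).injective]
    exact hc
  have hF₀u : ∀ u : Fin 1 × Fin (m + 1) → ℂ,
      aeval u F₀ = 0 ↔ ∃ β ∈ projZeros 𝔔, ∀ i : Fin 1, ∑ k, u (i, k) * β k = 0 := by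
    intro u
    rw [← aeval_chowForm_eq_zero_iff hhom hpr u, hFeq1, map_mul, aeval_C, ← algebraMap_int_eq,
      aeval_map_algebraMap]
    constructor
    · intro h
      rw [h, mul_zero]
    · intro h
      rcases mul_eq_zero.mp h with h | h
      · exact absurd h hc'
      · exact h
  -- degree `D` of every exponent
  have hdeg : ∀ γ ∈ F₀.support, ∑ v, γ v = D := by
    intro γ hγ
    rw [hsupp1] at hγ
    have hW := chowForm_isWeightedHomogeneous 𝔔 Nat.one_pos (0 : Fin 1) (mem_support_iff.mp hγ)
    rw [Finsupp.weight_apply, Finsupp.sum_fintype _ _ (fun _ => by simp)] at hW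
    simp only [smul_eq_mul] at hW
    have e : ∑ v : Fin 1 × Fin (m + 1), γ v * (if v.1 = (0 : Fin 1) then (1 : ℕ) else 0) =
        ∑ v, γ v := Finset.sum_congr rfl fun v _ => by rw [if_pos (Fin.eq_zero v.1), mul_one]
    rw [e] at hW
    exact hW
  -- the coefficients of `F₀` are bounded by `exp h(𝔔)`
  have hcoefF₀ : ∀ γ, ((|coeff γ F₀| : ℤ) : ℝ) ≤ Real.exp (iheight 𝔔 1) := by
    intro γ
    by_cases hγ : γ ∈ F₀.support
    · have h := log_abs_coeff_le_height_map F₀ hgcd hγ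
      rw [show height (map (Int.castRingHom ℚ) F₀) = iheight 𝔔 1 by
        rw [iheight, hFeq1, height_C_mul hc]] at h
      have hpos : (0 : ℝ) < ((|coeff γ F₀| : ℤ) : ℝ) := by
        exact_mod_cast abs_pos.mpr (mem_support_iff.mp hγ)
      rw [← Real.exp_log hpos]
      exact Real.exp_le_exp.mpr h
    · rw [notMem_support_iff.mp hγ]
      simpa using (Real.exp_pos _).le
  -- the polynomial `g = g_j`
  set g : Polynomial ℤ := gPoly F₀ j with hgdef
  have hgdeg : g.natDegree ≤ D := natDegree_gPoly_le F₀ j hdeg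
  have hgcoef : ∀ a, ((|g.coeff a| : ℤ) : ℝ) ≤ Real.exp (iheight 𝔔 1) := by
    intro a
    rw [hgdef, coeff_gPoly_eq F₀ j hdeg a, abs_mul, Int.cast_mul]
    refine (mul_le_of_le_one_right (by positivity) ?_).trans (hcoefF₀ _)
    exact_mod_cast abs_zpart_le_one j _
  -- `g ≠ 0`: its coefficient `D` is `F₀(e₀) ≠ 0` (no point of `V(𝔔)` at infinity)
  have hgD : g.coeff D ≠ 0 := by
    rw [hgdef, coeff_gPoly_eq F₀ j hdeg D]
    have hpe : pairExp j D D = Finsupp.single ((0 : Fin 1), (0 : Fin (m + 1))) D := by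
      rw [pairExp, Nat.sub_self, Finsupp.single_zero, add_zero]
    rw [hpe, zpart_single_zero, mul_one]
    intro h0
    have hev := aeval_e0_eq F₀ hdeg
    rw [h0, Int.cast_zero, hF₀u] at hev
    obtain ⟨β, hβ, hβsum⟩ := hev
    have := hβsum 0
    rw [Fin.sum_univ_succ] at this
    simp only [Fin.cons_zero, one_mul, Fin.cons_succ, Pi.zero_apply, zero_mul,
      Finset.sum_const_zero, add_zero] at this
    exact apply_zero_ne_zero_of_rank_one h𝔔 h𝔔c h1 hz hβ this
  have hg0 : g ≠ 0 := fun h => hgD (by rw [h, Polynomial.coeff_zero])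
  -- `g(z j) = 0`
  have hgz : Polynomial.aeval (z j) g = 0 := by
    rw [hgdef, ← aeval_uVec, hF₀u]
    refine ⟨_, hz, fun i => ?_⟩
    rw [Fin.sum_univ_succ]
    simp [uVec, Pi.single_apply, Finset.sum_ite_eq', ite_mul]
  -- an irreducible factor vanishing at `z j`
  obtain ⟨Q, hQmem, hQz⟩ : ∃ Q ∈ UniqueFactorizationMonoid.factors g,
      Polynomial.aeval (z j) Q = 0 := by
    obtain ⟨u, hu⟩ := UniqueFactorizationMonoid.factors_prod hg0
    have h := hgz
    rw [← hu, map_mul, mul_eq_zero] at h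
    rcases h with h | h
    · rw [map_multiset_prod, Multiset.prod_eq_zero_iff, Multiset.mem_map] at h
      obtain ⟨Q, hQ, hQ0⟩ := h
      exact ⟨Q, hQ, hQ0⟩
    · exact absurd h (u.isUnit.map (Polynomial.aeval (z j))).ne_zero
  have hQirr : Irreducible Q := UniqueFactorizationMonoid.irreducible_of_factor Q hQmem
  have hQdvd : Q ∣ g := UniqueFactorizationMonoid.dvd_of_mem_factors hQmem
  have hQdeg : Q.natDegree ≤ D := (Polynomial.natDegree_le_of_dvd hQdvd hg0).trans hgdeg
  have hQpos : 0 < Q.natDegree := by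
    by_contra h0
    have h0' : Q.natDegree = 0 := by omega
    have hQC : Q = Polynomial.C (Q.coeff 0) := Polynomial.eq_C_of_natDegree_eq_zero h0'
    rw [hQC, Polynomial.aeval_C, algebraMap_int_eq, eq_intCast, Int.cast_eq_zero] at hQz
    apply hQirr.ne_zero
    rw [hQC, hQz, map_zero]
  -- Mahler measure: `M(Q) ≤ M(g) ≤ (D+1) e^{h(𝔔)}`
  obtain ⟨r, hr⟩ := hQdvd
  have hr0 : r ≠ 0 := by
    rintro rfl
    exact hg0 (by rw [hr, mul_zero])
  set ι : ℤ →+* ℂ := Int.castRingHom ℂ with hι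
  have hmapg : g.map ι = Q.map ι * r.map ι := by rw [hr, Polynomial.map_mul]
  have hMr : 1 ≤ (r.map ι).mahlerMeasure := by
    refine Polynomial.one_le_mahlerMeasure_of_one_le_norm_leadingCoeff ?_
    rw [Polynomial.leadingCoeff_map_of_injective (RingHom.injective_int ι), hι, eq_intCast,
      Complex.norm_intCast]
    exact_mod_cast Int.one_le_abs (Polynomial.leadingCoeff_ne_zero.mpr hr0)
  have hMQ_le : (Q.map ι).mahlerMeasure ≤ (g.map ι).mahlerMeasure := by
    rw [hmapg, Polynomial.mahlerMeasure_mul]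
    exact le_mul_of_one_le_right (Polynomial.mahlerMeasure_nonneg _) hMr
  have hMg : (g.map ι).mahlerMeasure ≤ ((D : ℝ) + 1) * Real.exp (iheight 𝔔 1) := by
    refine (Polynomial.mahlerMeasure_le_sum_norm_coeff _).trans ?_
    rw [Polynomial.sum_def]
    have hsub : (g.map ι).support ⊆ Finset.range (D + 1) :=
      Polynomial.supp_subset_range (Nat.lt_succ_of_le (Polynomial.natDegree_map_le.trans hgdeg))
    refine (Finset.sum_le_sum_of_subset_of_nonneg hsub (fun i _ _ => norm_nonneg _)).trans ?_
    refine (Finset.sum_le_card_nsmul _ _ (Real.exp (iheight 𝔔 1)) fun i _ => ?_).trans ?_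
    · rw [Polynomial.coeff_map, hι, eq_intCast, Complex.norm_intCast, ← Int.cast_abs]
      exact hgcoef i
    · rw [Finset.card_range, nsmul_eq_mul]
      push_cast
      exact le_rfl
  have hQmap0 : Q.map ι ≠ 0 := (Polynomial.map_ne_zero_iff (RingHom.injective_int ι)).mpr hQirr.ne_zero
  have hMQpos : 0 < (Q.map ι).mahlerMeasure := Polynomial.mahlerMeasure_pos_of_ne_zero hQmap0
  refine ⟨Q, hQirr, hQpos, hQz, hQdeg, ?_⟩
  have hDpos : (0 : ℝ) < (D : ℝ) + 1 := by positivity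
  calc Real.log (Q.map ι).mahlerMeasure
      ≤ Real.log (((D : ℝ) + 1) * Real.exp (iheight 𝔔 1)) :=
        Real.log_le_log hMQpos (hMQ_le.trans hMg)
    _ = Real.log ((D : ℝ) + 1) + iheight 𝔔 1 := by
        rw [Real.log_mul hDpos.ne' (Real.exp_pos _).ne', Real.log_exp]
    _ ≤ iheight 𝔔 1 + (D : ℝ) := by
        have := Real.log_le_sub_one_of_pos hDpos
        linarith

end URes

/-! ## §D  Descent to the point through the components containing it, tracking the used generators

This is the induction of `PhilipponMain.descent_to_point` (tree, `PhilipponCriterionDescend`), run with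
the extra invariant «the finset `S` of generators already cut with»: the unmixed homogeneous prime `𝔔`
through `(1 : z)` of rank `r₀ - j` contains `E l` for `l ∈ S`, has `ideg ≤ ∏_{l ∈ S} d l` and
`iheight ≤ (∏_{l ∈ S} d l) · (A₀ + j · (Λ + m (r₀ + 1) + m²))`.  The new generator `E i ∉ 𝔔` supplied by
`exists_not_mem_of_finite_zeros` (the tree's «no isolated projective zeros in rank ≥ 2») is therefore NOT
in `S`, so the degree bound multiplies by a FRESH `d i` — this is what gives `∏ Dᵢ` over distinct
generators instead of `D_max ^ n`. -/

/-- **Tracked descent** (the induction of the tree's `PhilipponMain.descent_to_point` with the finset `S` of used generators in the invariant): from the unmixed homogeneous prime `𝔓₀ ∋ (1 : z)` of rank `r₀` down `j ≤ r₀ - 1` steps to an unmixed homogeneous prime `𝔔 ∋ (1 : z)` of rank `r₀ - j` containing `E l` for `l ∈ S`, with `ideg 𝔔 ≤ ∏_{l ∈ S} d l` and `iheight 𝔔 ≤ (∏_{l ∈ S} d l) · (A₀ + j · (Λ + m (r₀ + 1) + m²))`; each cut uses W1 `exists_not_mem_of_finite_zeros` (fed by `hfin`), Prop. 4.11, Lasker,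 `radical_component_facts` and `cut_component_facts` (Prop. 4.7). -/
theorem descent_tracked (h47 : NesterenkoPhilippon2001_ch3_prop_4_7)
    (h411 : NesterenkoPhilippon2001_ch3_prop_4_11) {m : ℕ} {ι : Type*} [Finite ι] [DecidableEq ι]
    {r₀ : ℕ} (hr₀1 : 1 ≤ r₀) (hr₀m : r₀ ≤ m) {𝔓₀ : Ideal (Rx m)} (h𝔓₀ : 𝔓₀.IsPrime)
    (h𝔓₀hom : 𝔓₀.IsHomogeneous (homogeneousSubmodule (Fin (m + 1)) ℚ))
    (h𝔓₀unm : IsUnmixedOfRank 𝔓₀ r₀)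
    (θ : Fin m → ℂ) {ρ₀ : ℝ} (hρ₀ : 0 < ρ₀) (E : ι → Rx m) (d : ι → ℕ)
    (hEhom : ∀ l, (E l).IsHomogeneous (d l)) {Λ A₀ : ℝ} (hΛ : 0 ≤ Λ) (hA₀ : 0 ≤ A₀)
    (hhE : ∀ l, height (E l) ≤ Λ)
    (hfin : Set.Finite {z : Fin m → ℂ | (∀ i, ‖z i - θ i‖ ≤ ρ₀) ∧
      ∀ l, aeval (Fin.cons 1 z : Fin (m + 1) → ℂ) (E l) = 0})
    {z : Fin m → ℂ} (hz : (Fin.cons 1 z : Fin (m + 1) → ℂ) ∈ projZeros 𝔓₀) (hzθ : ∀ i, ‖z i - θ i‖ < ρ₀)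
    (hzE : ∀ l, aeval (Fin.cons 1 z : Fin (m + 1) → ℂ) (E l) = 0)
    (S₀ : Finset ι) (hS₀ : ∀ l ∈ S₀, E l ∈ 𝔓₀)
    (hdeg₀ : (ideg 𝔓₀ r₀ : ℝ) ≤ ∏ l ∈ S₀, (d l : ℝ))
    (hh₀ : iheight 𝔓₀ r₀ ≤ (∏ l ∈ S₀, (d l : ℝ)) * A₀) :
    ∀ j : ℕ, j < r₀ → ∃ (𝔔 : Ideal (Rx m)) (S : Finset ι), 𝔔.IsPrime ∧
      𝔔.IsHomogeneous (homogeneousSubmodule (Fin (m + 1)) ℚ) ∧ IsUnmixedOfRank 𝔔 (r₀ - j) ∧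
      (Fin.cons 1 z : Fin (m + 1) → ℂ) ∈ projZeros 𝔔 ∧ (∀ l ∈ S, E l ∈ 𝔔) ∧
      (ideg 𝔔 (r₀ - j) : ℝ) ≤ ∏ l ∈ S, (d l : ℝ) ∧
      iheight 𝔔 (r₀ - j) ≤
        (∏ l ∈ S, (d l : ℝ)) * (A₀ + j * (Λ + ((m : ℝ) * (r₀ + 1) + (m : ℝ) ^ 2))) := by
  classical
  set cm : ℝ := (m : ℝ) * (r₀ + 1) + (m : ℝ) ^ 2 with hcm
  have hcm0 : 0 ≤ cm := by positivity
  intro j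
  induction j with
  | zero =>
    intro _
    refine ⟨𝔓₀, S₀, h𝔓₀, h𝔓₀hom, by simpa using h𝔓₀unm, hz, hS₀, by simpa using hdeg₀, ?_⟩
    simpa using hh₀
  | succ j ih =>
    intro hj
    obtain ⟨𝔔, S, h𝔔, h𝔔hom, h𝔔unm, hz𝔔, hES, hdeg𝔔, hh𝔔⟩ := ih (by omega)
    have hr2 : 2 ≤ r₀ - j := by omega
    have hrm : r₀ - j ≤ m := by omega
    -- a generator outside `𝔔` (no isolated projective zeros in rank `≥ 2`); it is not in `S`
    obtain ⟨i, hi⟩ := exists_not_mem_of_finite_zeros hr2 h𝔔 h𝔔hom h𝔔unm θ E hfin hz𝔔 hzθ hρ₀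
    have hiS : i ∉ S := fun h => hi (hES i h)
    -- `d i ≥ 1`: `E i ≠ 0` vanishes at `(1 : z)`, so it is not a constant
    have hdi : 1 ≤ d i := by
      by_contra hd0
      have hd0' : d i = 0 := by omega
      have hE0 : E i ≠ 0 := fun h => hi (h ▸ 𝔔.zero_mem)
      have h00 : (E i).totalDegree = 0 := by
        have := (hEhom i).totalDegree_le
        omega
      have hEC : E i = C (coeff 0 (E i)) := totalDegree_eq_zero_iff_eq_C.mp h00
      have hc0 : coeff 0 (E i) ≠ 0 := fun hc => hE0 (by rw [hEC, hc, C_0])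
      apply hc0
      have h2 := hzE i
      rw [hEC, aeval_C] at h2
      exact (map_eq_zero_iff _ (algebraMap ℚ ℂ).injective).mp h2
    -- Prop. 4.11's `J'` for `(𝔔, E i)` and the component through `(1 : z)`
    obtain ⟨J', hJ'hom, hJ'unm, hJ'V, -, -, -⟩ :=
      (h411 m (r₀ - j) 𝔔 (E i) (d i) (by omega) hrm h𝔔 h𝔔hom h𝔔unm (hEhom i) hdi hi).1 hr2
    obtain ⟨t', ht'⟩ : ∃ t' : Finset (Ideal (Rx m)), Submodule.IsMinimalPrimaryDecomposition J' t' :=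
      Submodule.IsLasker.exists_isMinimalPrimaryDecomposition (Submodule.isLasker (Rx m) (Rx m)) J'
    have hzJ' : (Fin.cons 1 z : Fin (m + 1) → ℂ) ∈ projZeros J' := by
      rw [hJ'V, projZeros_sup, projZeros_span_singleton]
      exact ⟨hz𝔔, hz𝔔.1, hzE i⟩
    have hzU : (Fin.cons 1 z : Fin (m + 1) → ℂ) ∈ ⋃ Q ∈ t', projZeros Q.radical := by
      rw [← projZeros_eq_biUnion_radical ht'.inf_eq]; exact hzJ'
    obtain ⟨Q, hQ, hzQ⟩ := Set.mem_iUnion₂.mp hzU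
    obtain ⟨hQprime, hQhom, hQunm, -, -⟩ :=
      Literature.Barriers.Schanuel.radical_component_facts hJ'hom hJ'unm ht' hQ
    obtain ⟨h𝔔Q, hEQ, hdegQ, hhQ⟩ := cut_component_facts h47 h411 hr2 hrm h𝔔 h𝔔hom h𝔔unm (hEhom i) hi
      hJ'hom hJ'unm hJ'V ht' hQ ⟨_, hzQ⟩
    have hrank : r₀ - (j + 1) = r₀ - j - 1 := by omega
    -- the products over `S` and `insert i S`
    set P : ℝ := ∏ l ∈ S, (d l : ℝ) with hP
    have hP0 : 0 ≤ P := Finset.prod_nonneg fun l _ => Nat.cast_nonneg _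
    have hPins : ∏ l ∈ insert i S, (d l : ℝ) = (d i : ℝ) * P := Finset.prod_insert hiS
    have hdi1 : (1 : ℝ) ≤ d i := by exact_mod_cast hdi
    have hPP : P ≤ (d i : ℝ) * P := by nlinarith
    refine ⟨Q.radical, insert i S, hQprime, hQhom, by rwa [hrank], hzQ, ?_, ?_, ?_⟩
    · -- generators used so far lie in the new prime
      intro l hl
      rcases Finset.mem_insert.mp hl with rfl | hl
      · exact hEQ
      · exact h𝔔Q (hES l hl)
    · -- degree
      rw [hrank, hPins]
      have h1 : (ideg Q.radical (r₀ - j - 1) : ℝ) ≤ (ideg 𝔔 (r₀ - j) : ℝ) * d i := by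
        exact_mod_cast hdegQ
      calc (ideg Q.radical (r₀ - j - 1) : ℝ) ≤ (ideg 𝔔 (r₀ - j) : ℝ) * d i := h1
        _ ≤ P * d i := mul_le_mul_of_nonneg_right hdeg𝔔 (Nat.cast_nonneg _)
        _ = (d i : ℝ) * P := by ring
    · -- height
      rw [hrank, hPins]
      have hdeg0 : (0 : ℝ) ≤ ideg 𝔔 (r₀ - j) := Nat.cast_nonneg _
      have hh0 : 0 ≤ iheight 𝔔 (r₀ - j) := height_nonneg _
      have hdi0 : (0 : ℝ) ≤ d i := Nat.cast_nonneg _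
      have hjB : 0 ≤ A₀ + j * (Λ + cm) := by positivity
      have hr : ((r₀ - j : ℕ) : ℝ) + 1 ≤ (r₀ : ℝ) + 1 := by
        have : ((r₀ - j : ℕ) : ℝ) ≤ r₀ := by exact_mod_cast Nat.sub_le r₀ j
        linarith
      -- the three terms of `cut_component_facts`
      have e1 : iheight 𝔔 (r₀ - j) * (d i : ℝ) ≤ ((d i : ℝ) * P) * (A₀ + j * (Λ + cm)) := by
        calc iheight 𝔔 (r₀ - j) * (d i : ℝ) ≤ (P * (A₀ + j * (Λ + cm))) * d i :=
              mul_le_mul_of_nonneg_right hh𝔔 hdi0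
          _ = ((d i : ℝ) * P) * (A₀ + j * (Λ + cm)) := by ring
      have e2 : height (E i) * (ideg 𝔔 (r₀ - j) : ℝ) ≤ Λ * ((d i : ℝ) * P) := by
        calc height (E i) * (ideg 𝔔 (r₀ - j) : ℝ) ≤ Λ * P :=
              mul_le_mul (hhE i) hdeg𝔔 hdeg0 hΛ
          _ ≤ Λ * ((d i : ℝ) * P) := mul_le_mul_of_nonneg_left hPP hΛ
      have e3 : ((m : ℝ) * ((r₀ - j : ℕ) + 1) + (m : ℝ) ^ 2) * ideg 𝔔 (r₀ - j) * d i ≤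
          cm * ((d i : ℝ) * P) := by
        have e31 : (m : ℝ) * ((r₀ - j : ℕ) + 1) + (m : ℝ) ^ 2 ≤ cm := by
          rw [hcm]; nlinarith [(Nat.cast_nonneg m : (0 : ℝ) ≤ m)]
        have e30 : 0 ≤ (m : ℝ) * ((r₀ - j : ℕ) + 1) + (m : ℝ) ^ 2 := by positivity
        calc ((m : ℝ) * ((r₀ - j : ℕ) + 1) + (m : ℝ) ^ 2) * ideg 𝔔 (r₀ - j) * d i
            ≤ cm * P * d i := by
              apply mul_le_mul_of_nonneg_right _ hdi0
              exact mul_le_mul e31 hdeg𝔔 hdeg0 hcm0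
          _ = cm * ((d i : ℝ) * P) := by ring
      calc iheight Q.radical (r₀ - j - 1)
          ≤ iheight 𝔔 (r₀ - j) * (d i : ℝ) + height (E i) * (ideg 𝔔 (r₀ - j) : ℝ) +
              ((m : ℝ) * ((r₀ - j : ℕ) + 1) + (m : ℝ) ^ 2) * ideg 𝔔 (r₀ - j) * d i := hhQ
        _ ≤ ((d i : ℝ) * P) * (A₀ + j * (Λ + cm)) + Λ * ((d i : ℝ) * P) + cm * ((d i : ℝ) * P) := by
              linarith [e1, e2, e3]
        _ = ((d i : ℝ) * P) * (A₀ + ((j + 1 : ℕ) : ℝ) * (Λ + cm)) := by push_cast; ring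

/-! ## §A  Arithmetic of the constants and small lemmas for the assembly -/

/-- Coefficients bounded by `H` ⇒ `log (naive height) ≤ log H`. -/
theorem log_mvPolyHeight_le {n : ℕ} {Q : MvPolynomial (Fin n) ℤ} {H : ℕ} (hH : 1 ≤ H)
    (hc : ∀ e, |Q.coeff e| ≤ (H : ℤ)) : Real.log (mvPolyHeight Q) ≤ Real.log H := by
  have hQH : mvPolyHeight Q ≤ H := by
    unfold mvPolyHeight
    refine Finset.sup_le fun e _ => ?_
    have h1 : (((Q.coeff e).natAbs : ℕ) : ℤ) ≤ H := by
      rw [Int.natCast_natAbs]; exact hc e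
    exact_mod_cast h1
  rcases Nat.eq_zero_or_pos (mvPolyHeight Q) with h0 | hpos
  · rw [h0, Nat.cast_zero, Real.log_zero]
    exact Real.log_nonneg (by exact_mod_cast hH)
  · exact Real.log_le_log (by exact_mod_cast hpos) (by exact_mod_cast hQH)

/-- THE JUNK-TERM ARITHMETIC (announced constant `6 n³`).  Starting height `Λ + 2n²` (Prop. 4.8's
`m² d` and Prop. 4.7's `m² deg`), `n - 1` cuts each adding `Λ + (n (n+1) + n²)` (Prop. 4.11 via
`cut_component_facts`, rank `r ≤ n`), and the final `+ 1 · deg` of the Mahler-measure step: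
`Λ + 2n² + (n-1)(Λ + 2n² + n) + 1 = nΛ + 2n³ + n² - n + 1 ≤ nΛ + 6n³` for `n ≥ 1`. -/
theorem junk_absorb {n : ℕ} (hn : 1 ≤ n) (Λ : ℝ) :
    Λ + 2 * (n : ℝ) ^ 2 + ((n : ℝ) - 1) * (Λ + ((n : ℝ) * (n + 1) + (n : ℝ) ^ 2)) + 1 ≤
      (n : ℝ) * Λ + 6 * (n : ℝ) ^ 3 := by
  have hn1 : (1 : ℝ) ≤ n := by exact_mod_cast hn
  nlinarith [mul_nonneg (sub_nonneg.mpr hn1) (sub_nonneg.mpr hn1), sq_nonneg ((n : ℝ) - 1)]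

/-- The sharp (Krick–Pardo–Sombra-quality) numeral of the tree's `IsolatedPointBound` is below the
announced one: `(2n+3) log(n+1) ≤ 6 n³` (both sides vanish at `n = 0`). -/
theorem sharp_le_junk (n : ℕ) : (2 * (n : ℝ) + 3) * Real.log ((n : ℝ) + 1) ≤ 6 * (n : ℝ) ^ 3 := by
  rcases Nat.eq_zero_or_pos n with rfl | hn
  · simp
  · have hn1 : (1 : ℝ) ≤ n := by exact_mod_cast hn
    have hlog : Real.log ((n : ℝ) + 1) ≤ n := by
      have := Real.log_le_sub_one_of_pos (show (0 : ℝ) < n + 1 by positivity)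
      linarith
    have hlog0 : 0 ≤ Real.log ((n : ℝ) + 1) := Real.log_nonneg (by linarith)
    have h2 : (n : ℝ) ^ 2 ≤ (n : ℝ) ^ 3 := pow_le_pow_right₀ hn1 (by norm_num)
    have h3 : (n : ℝ) ≤ (n : ℝ) ^ 3 := by
      calc (n : ℝ) = (n : ℝ) ^ 1 := (pow_one _).symm
        _ ≤ (n : ℝ) ^ 3 := pow_le_pow_right₀ hn1 (by norm_num)
    have h4 : 0 ≤ (n : ℝ) ^ 3 := by positivity
    calc (2 * (n : ℝ) + 3) * Real.log ((n : ℝ) + 1) ≤ (2 * (n : ℝ) + 3) * n :=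
          mul_le_mul_of_nonneg_left hlog (by positivity)
      _ = 2 * (n : ℝ) ^ 2 + 3 * n := by ring
      _ ≤ 6 * (n : ℝ) ^ 3 := by linarith

end IsolatedPt

end Summit.Schanuel.Schanuel.Theorems.RootDecomp1BMovingZero

end
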